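import Summits.QuantumFields.YangMills.Theorems.BalabanUVNodesN21LowCentreEndChartLetter
import Summits.QuantumFields.YangMills.Theorems.BalabanUVNodesN21ShellSplitOfRecord13CoPHLaw

/-!
# N21 (NE7c) · THE LOW-CENTRE ENDs AT THE RECORD's TRUNCATED CUBE LAW `cubeLawOfDatum₉ … t a`: chart transport of
# p590709 ★★★ ∕ p592783 ★★★★ onto n21-d's shell split of record (the integral-form (M1) `Σ_s shellPiece ≤ (Dρ)·Σ_s cubeWeight`)

Width seat pub-ymgap-dag-n21-w1 (g0; director-ym №197 ∕ HUMAN RULING D-0149), node N21 = NE7c (single-run shell-weight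
bound, NOT PRINTED in [Bałaban 1983–89], NOT proved), lane K3⁷ `SpineGivenEndpointR13SepCoPH` (stmt-QuantumFields-20544,
`--kind proof --supports … --as helper`).  Seventh file of the seat's item-1 chain; the piece worded «YOURS» by dag-n21-d
g9 (bus I.25963) after dag-n21-e g19's in-row word (I.≈25879).  Consumes BY NAME: n21-d g9 FILE 4
`…N21ShellSplitOfRecord13CoPHLaw.cubeAC_of_slotAntiConcentration` (★★★: (M1) as `SlotAntiConcentration` on the record's
`a`-truncated dressed law ⇒ the integral-form (M1) of the shell split of record), the Literature transport lemmas
`T4ShellMeasureFibre.slotAntiConcentration_of_dominated` ∕ `slotAntiConcentration_comap` (the chart pattern of n21-e's 38s,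
cited — no generic lemma restated here), and this seat's ENDs p590709 `slotAntiConcentration_restrict_of_sect1Letters` ∕
p592783 `slotAntiConcentration_chartLetter_of_sect1Letters`.

WHAT.  A measurable CHART `Φ` from the record's field space `GaugeField (F.P p.K) k (SU N)` to the block frame
`X × (κ → ℝ)` (exterior point, block chart of (1.2) centred at the background) with a DICTIONARY of two inequalities — the
shell mass of the image law `(cubeLawOfDatum₉ … t a).map Φ` is at most the frame law's, and the frame law's total mass is
at most `M_dom ×` the image law's — and a statistic READING the cube's two tests through the chart (`U (Φ V) < ε_k ↔
χ_a^{ε_k}(V) = 1`, same at `ε_k(1−ρ)`) transport the frame-side (M1) to the record: ★★★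
`cubeAC_of_sect1Letters_chart` (p590709's binders on the frame + chart + dictionary ⇒ `Σ_s shellPiece … ρ t a s ≤
((3(#κ+1)(1+Q)∕(κ₀(1−ρ)))·M_dom·ρ)·Σ_s cubeWeight … t a s`) and ★★★★ `cubeAC_of_chartLetter_chart` (p592783's: the
statistic is the block's own sup-norm letter, constant `(3(#κ+1)∕(1−ρ))·M_dom`).

HONEST FRAMING.  Composition BY NAME + [folklore] transport; 0 def, 0 sorry; a LOCATED JUNCTION: the chart `Φ`, the
dictionary (`hS`, `hmass`), the test-reading clauses (`hu`, `hu′`) and every frame-side binder are HYPOTHESES — the joint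
system is NOT exhibited here (NODE 00's objects: n21-d g9 PRE-INTENT FILE 5 «block disintegration» is the producer of the
dictionary by Tonelli); nothing of Bałaban's asserted; NE7c NOT PRINTED ∕ NOT proved; N21 NOT discharged; counts unmoved
(typed 28∕28 · discharged 5∕27); count-neutral; one finite 𝕋⁴ at fixed ε — R4 would close only the conditional finite-𝕋⁴
rung `BalabanLadder.UV`, NOT the Yang–Mills mass gap (Clay); nothing about ℝ⁴ ∕ OS.
-/

set_option autoImplicit false

noncomputable section

open MeasureTheory Set Function Finset
open scoped ENNReal BigOperators

namespace Summit.QuantumFields.YangMills.Theorems.N21LowCentreEndAtCubeLaw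

open Literature.MathematicalPhysics.QuantumFieldTheory.Balaban1983to89
open Literature.MathematicalPhysics.QuantumFieldTheory.Balaban1983to89.T4Continuum
open Literature.MathematicalPhysics.QuantumFieldTheory.Balaban1983to89.Node00
open Literature.MathematicalPhysics.QuantumFieldTheory.Balaban1983to89.T4ShellMeasure (SlotAntiConcentration)
open Literature.MathematicalPhysics.QuantumFieldTheory.Balaban1983to89.T4ShellMeasureFibre
  (slotAntiConcentration_of_dominated slotAntiConcentration_comap)
open Literature.MathematicalPhysics.QuantumFieldTheory.Balaban1983to89.B16Sect1Wilson (Ineq16 Ineq19)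
open Summit.QuantumFields.YangMills.Theorems.N21ShellSplitOfRecord13CoPH
  (cubeChiAt shellPieceOfDatum₉ cubeWeightOfDatum₉ cubeLawOfDatum₉ cubeAC_of_slotAntiConcentration)
open Summit.QuantumFields.YangMills.Theorems.N21LowCentreEndSect1Letters (slotAntiConcentration_restrict_of_sect1Letters)
open Summit.QuantumFields.YangMills.Theorems.N21LowCentreEndChartLetter (slotAntiConcentration_chartLetter_of_sect1Letters)

variable (F : T4Family) (N : ℕ) [NeZero N] (ϑ : Stage9Params F N) (Dt : FiniteEpsData F (SU N)) (g₀ : ℕ → ℝ)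
  (os : List (ULoop F)) (p : B12.RunParams) (g : ℕ → ℝ) (k : ℕ)

variable {X : Type*} [MeasurableSpace X] {κ : Type*} [Fintype κ]

/-- ★★★ **THE [LF-II] §1-LETTERS END AT THE RECORD's TRUNCATED CUBE LAW.**  p590709's ★★★ (every analytic binder a
PRINTED ROW on the chart or the ONE clause, at the cube's letter `θ = ε_k = epsOfRecord`) + a measurable chart `Φ` into
the frame + the two-inequality dictionary + the test-reading clauses ⇒ n21-d FILE 4's integral-form (M1) at cube `a`:
`Σ_s shellPiece … ρ t a s ≤ ((3(#κ+1)(1+Q)∕(κ₀(1−ρ)))·M_dom·ρ)·Σ_s cubeWeight … t a s`.  LOCATED junction (A2 joint system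
not exhibited). [folklore] -/
theorem cubeAC_of_sect1Letters_chart
    (hUbg : LocalBgMeasurable F N ϑ.ν) (hw0 : ∀ k s' U V', 0 ≤ wOfRecord₉ F N ϑ p g k s' U V') {ρ : ℝ}
    (hρ0 : 0 < ρ) (hρ1 : ρ < 1) (t : ℝ)
    (a : ↥(cubeIndices (F.P p.K) (cubeSide (F.P p.K).L ϑ.ν.M₂ (RkOfRecord (F.P p.K).L ϑ.ν.r (g k)) k)))
    (hint : ∀ s : SeqOfRecord F ϑ.ν ϑ.τ9.M g p.K k,
      Integrable (fun V => chiSeqOfRecord F N ϑ.ν ϑ.τ9.M g p.K k s V * dressedSlotsOfDatum₉ F N ϑ Dt g₀ os t p g k s V)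
        (fieldMeasure (F.P p.K) k (SU N)))
    (hε : 0 < epsOfRecord ϑ.ν g k)
    -- the block frame of [LF-II] (1.2) and p590709's binders, at the cube's letter `θ = ε_k`
    [Nonempty κ] (ζ : Measure X) [SFinite ζ] (K : X → Set (κ → ℝ)) (φ Qf lin Vt : X → (κ → ℝ) → ℝ)
    (hg : Measurable fun q : X × (κ → ℝ) =>
      (K q.1).indicator (fun w => ENNReal.ofReal (Real.exp (-φ q.1 w))) q.2)
    {U : X × (κ → ℝ) → ℝ} (hUm : Measurable U)
    {C Env : Set (X × (κ → ℝ))} (hC : MeasurableSet C) (hEnv : MeasurableSet Env)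
    {σ κ₀ Q L γ₀ M B₃ M₀ A₀ p₀g Rk WV Mdom : ℝ} {d : ℕ}
    (hρσ : ρ + σ ≤ 1) (hκ : 0 < κ₀) (hQ0 : 0 ≤ Q) (hL : 0 < L) (hd : 1 ≤ d) (hM : 0 < M) (hγ₀ : 0 < γ₀)
    (hW : 0 ≤ 3 * B₃ * M₀ * A₀ ^ 2 * p₀g ^ 2 * Real.exp (-Rk) * (100 * M) ^ 4 + WV) (hMdom : 0 ≤ Mdom)
    (hK : ∀ z, Convex ℝ (K z)) (hφ : ∀ z, ConvexOn ℝ (K z) (φ z)) (h0K : ∀ z, (0 : κ → ℝ) ∈ K z)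
    (hexp : ∀ z, ∀ v ∈ K z, φ z v = φ z 0 + 1 / 2 * Qf z v + lin z v + Vt z v)
    (h19 : ∀ z, ∀ v ∈ K z, Ineq19 (Qf z v) (∑ b, v b ^ 2) γ₀ d M)
    (h16 : ∀ z, ∀ v ∈ K z, Ineq16 (lin z v) B₃ M₀ A₀ p₀g Rk M)
    (hV : ∀ z, ∀ v ∈ K z, |Vt z v| ≤ WV)
    (hU : ∀ z (a b : κ → ℝ), U (z, a) - U (z, b) ≤ L * ‖a - b‖)
    (hUc : ∀ z, U (z, 0) ≤ σ * epsOfRecord ϑ.ν g k)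
    (hclause : 16 * (3 * B₃ * M₀ * A₀ ^ 2 * p₀g ^ 2 * Real.exp (-Rk) * (100 * M) ^ 4 + WV) * d
      * (100 * M) ^ (d + 1) * L ^ 2 ≤ γ₀ * (epsOfRecord ϑ.ν g k * (1 - ρ - σ)) ^ 2)
    (henv : ∀ l ∈ Icc (1 - 1 / ((Fintype.card κ : ℝ) + 1)) 1, ∀ q : X × (κ → ℝ),
      epsOfRecord ϑ.ν g k * (1 - ρ) ≤ U q → U q < epsOfRecord ϑ.ν g k → q ∈ C →
        (q.1, (0 : κ → ℝ) + l • (q.2 - 0)) ∈ Env)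
    (hRT : ∀ q : X × (κ → ℝ), epsOfRecord ϑ.ν g k * (1 - ρ) ≤ U q → U q < epsOfRecord ϑ.ν g k → q ∈ C →
      ∀ s : ℝ, 1 ≤ s →
      epsOfRecord ϑ.ν g k * (1 - ρ) ≤ U (q.1, (0 : κ → ℝ) + s • (q.2 - 0)) →
        U (q.1, (0 : κ → ℝ) + s • (q.2 - 0)) < epsOfRecord ϑ.ν g k → (q.1, (0 : κ → ℝ) + s • (q.2 - 0)) ∈ C →
          U q + κ₀ * (epsOfRecord ϑ.ν g k * (1 - ρ)) * (s - 1) ≤ U (q.1, (0 : κ → ℝ) + s • (q.2 - 0)))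
    (hQ : ((ζ.prod volume).withDensity fun q : X × (κ → ℝ) =>
        (K q.1).indicator (fun w => ENNReal.ofReal (Real.exp (-φ q.1 w))) q.2)
          (Env \ ({q | U q < epsOfRecord ϑ.ν g k} ∩ C))
      ≤ ENNReal.ofReal Q * ((ζ.prod volume).withDensity fun q : X × (κ → ℝ) =>
        (K q.1).indicator (fun w => ENNReal.ofReal (Real.exp (-φ q.1 w))) q.2) ({q | U q < epsOfRecord ϑ.ν g k} ∩ C))
    -- the chart and the dictionary
    (Φ : GaugeField (F.P p.K) k (SU N) → X × (κ → ℝ)) (hΦ : Measurable Φ)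
    (hS : ((cubeLawOfDatum₉ F N ϑ Dt g₀ os p g k t a).map Φ)
        {q | epsOfRecord ϑ.ν g k * (1 - ρ) ≤ U q ∧ U q < epsOfRecord ϑ.ν g k}
      ≤ ((((ζ.prod volume).withDensity fun q : X × (κ → ℝ) =>
          (K q.1).indicator (fun w => ENNReal.ofReal (Real.exp (-φ q.1 w))) q.2)).restrict
            ({q | U q < epsOfRecord ϑ.ν g k} ∩ C))
        {q | epsOfRecord ϑ.ν g k * (1 - ρ) ≤ U q ∧ U q < epsOfRecord ϑ.ν g k})
    (hmass : ((((ζ.prod volume).withDensity fun q : X × (κ → ℝ) =>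
          (K q.1).indicator (fun w => ENNReal.ofReal (Real.exp (-φ q.1 w))) q.2)).restrict
            ({q | U q < epsOfRecord ϑ.ν g k} ∩ C)) Set.univ
      ≤ ENNReal.ofReal Mdom * ((cubeLawOfDatum₉ F N ϑ Dt g₀ os p g k t a).map Φ) Set.univ)
    -- the statistic reads the cube's two tests through the chart
    (hu : ∀ V, U (Φ V) < epsOfRecord ϑ.ν g k ↔ cubeChiAt F N ϑ.ν g p.K k (epsOfRecord ϑ.ν g k) a V = 1)
    (hu' : ∀ V, U (Φ V) < epsOfRecord ϑ.ν g k * (1 - ρ) ↔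
      cubeChiAt F N ϑ.ν g p.K k (epsOfRecord ϑ.ν g k * (1 - ρ)) a V = 1) :
    ∑ s, shellPieceOfDatum₉ F N ϑ Dt g₀ os p g k ρ t a s
      ≤ (3 * ((Fintype.card κ : ℝ) + 1) * (1 + Q) / (κ₀ * (1 - ρ)) * Mdom * ρ)
        * ∑ s, cubeWeightOfDatum₉ F N ϑ Dt g₀ os p g k t a s := by
  -- (M1) on the frame law, every analytic binder a printed row or the clause
  have hEND := slotAntiConcentration_restrict_of_sect1Letters ζ K φ Qf lin Vt hg hUm hC hEnv hε hρ0 hρ1 hρσ hκ hQ0 hL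
    hd hM hγ₀ hW hK hφ h0K hexp h19 h16 hV hU hUc hclause henv hRT hQ
  have hD0 : 0 ≤ 3 * ((Fintype.card κ : ℝ) + 1) * (1 + Q) / (κ₀ * (1 - ρ)) := by
    have : 0 < 1 - ρ := by linarith
    positivity
  -- transport: domination dictionary, then the chart
  have h1 := slotAntiConcentration_of_dominated hD0 hρ0.le hS hEND hmass
  have h2 : SlotAntiConcentration (cubeLawOfDatum₉ F N ϑ Dt g₀ os p g k t a) (U ∘ Φ) (epsOfRecord ϑ.ν g k) ρ
      (3 * ((Fintype.card κ : ℝ) + 1) * (1 + Q) / (κ₀ * (1 - ρ)) * Mdom) := slotAntiConcentration_comap hΦ h1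
  exact cubeAC_of_slotAntiConcentration F N ϑ Dt g₀ os p g k hUbg hw0 hρ0.le t a hint (U ∘ Φ) hu hu'
    (mul_nonneg hD0 hMdom) h2

/-- ★★★★ **THE CHART-LETTER SPECIES AT THE RECORD's TRUNCATED CUBE LAW.**  p592783's ★★★★ (statistic = the block's own
sup-norm letter; part 28's geometric binders discharged) + chart + dictionary + test-reading ⇒
`Σ_s shellPiece … ρ t a s ≤ ((3(#κ+1)∕(1−ρ))·M_dom·ρ)·Σ_s cubeWeight … t a s` — displayed: convexity, the PRINTED ROWS on the
chart, the ONE clause `16·W·d·(100M)^{d+1} ≤ γ₀(ε_k(1−ρ))²`, the chart, the dictionary, the test-reading clauses.  LOCATED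
junction. [folklore] -/
theorem cubeAC_of_chartLetter_chart
    (hUbg : LocalBgMeasurable F N ϑ.ν) (hw0 : ∀ k s' U V', 0 ≤ wOfRecord₉ F N ϑ p g k s' U V') {ρ : ℝ}
    (hρ0 : 0 < ρ) (hρ1 : ρ < 1) (t : ℝ)
    (a : ↥(cubeIndices (F.P p.K) (cubeSide (F.P p.K).L ϑ.ν.M₂ (RkOfRecord (F.P p.K).L ϑ.ν.r (g k)) k)))
    (hint : ∀ s : SeqOfRecord F ϑ.ν ϑ.τ9.M g p.K k,
      Integrable (fun V => chiSeqOfRecord F N ϑ.ν ϑ.τ9.M g p.K k s V * dressedSlotsOfDatum₉ F N ϑ Dt g₀ os t p g k s V)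
        (fieldMeasure (F.P p.K) k (SU N)))
    (hε : 0 < epsOfRecord ϑ.ν g k)
    [Nonempty κ] (ζ : Measure X) [SFinite ζ] (K : X → Set (κ → ℝ)) (φ Qf lin Vt : X → (κ → ℝ) → ℝ)
    (hg : Measurable fun q : X × (κ → ℝ) =>
      (K q.1).indicator (fun w => ENNReal.ofReal (Real.exp (-φ q.1 w))) q.2)
    {γ₀ M B₃ M₀ A₀ p₀g Rk WV Mdom : ℝ} {d : ℕ} (hd : 1 ≤ d) (hM : 0 < M) (hγ₀ : 0 < γ₀)
    (hW : 0 ≤ 3 * B₃ * M₀ * A₀ ^ 2 * p₀g ^ 2 * Real.exp (-Rk) * (100 * M) ^ 4 + WV) (hMdom : 0 ≤ Mdom)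
    (hK : ∀ z, Convex ℝ (K z)) (hφ : ∀ z, ConvexOn ℝ (K z) (φ z)) (h0K : ∀ z, (0 : κ → ℝ) ∈ K z)
    (hexp : ∀ z, ∀ v ∈ K z, φ z v = φ z 0 + 1 / 2 * Qf z v + lin z v + Vt z v)
    (h19 : ∀ z, ∀ v ∈ K z, Ineq19 (Qf z v) (∑ b, v b ^ 2) γ₀ d M)
    (h16 : ∀ z, ∀ v ∈ K z, Ineq16 (lin z v) B₃ M₀ A₀ p₀g Rk M)
    (hV : ∀ z, ∀ v ∈ K z, |Vt z v| ≤ WV)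
    (hclause : 16 * (3 * B₃ * M₀ * A₀ ^ 2 * p₀g ^ 2 * Real.exp (-Rk) * (100 * M) ^ 4 + WV) * d
      * (100 * M) ^ (d + 1) ≤ γ₀ * (epsOfRecord ϑ.ν g k * (1 - ρ)) ^ 2)
    (Φ : GaugeField (F.P p.K) k (SU N) → X × (κ → ℝ)) (hΦ : Measurable Φ)
    (hS : ((cubeLawOfDatum₉ F N ϑ Dt g₀ os p g k t a).map Φ)
        {q : X × (κ → ℝ) | epsOfRecord ϑ.ν g k * (1 - ρ) ≤ ‖q.2‖ ∧ ‖q.2‖ < epsOfRecord ϑ.ν g k}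
      ≤ ((((ζ.prod volume).withDensity fun q : X × (κ → ℝ) =>
          (K q.1).indicator (fun w => ENNReal.ofReal (Real.exp (-φ q.1 w))) q.2)).restrict
            ({q : X × (κ → ℝ) | ‖q.2‖ < epsOfRecord ϑ.ν g k} ∩ univ))
        {q : X × (κ → ℝ) | epsOfRecord ϑ.ν g k * (1 - ρ) ≤ ‖q.2‖ ∧ ‖q.2‖ < epsOfRecord ϑ.ν g k})
    (hmass : ((((ζ.prod volume).withDensity fun q : X × (κ → ℝ) =>
          (K q.1).indicator (fun w => ENNReal.ofReal (Real.exp (-φ q.1 w))) q.2)).restrict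
            ({q : X × (κ → ℝ) | ‖q.2‖ < epsOfRecord ϑ.ν g k} ∩ univ)) Set.univ
      ≤ ENNReal.ofReal Mdom * ((cubeLawOfDatum₉ F N ϑ Dt g₀ os p g k t a).map Φ) Set.univ)
    (hu : ∀ V, ‖(Φ V).2‖ < epsOfRecord ϑ.ν g k ↔ cubeChiAt F N ϑ.ν g p.K k (epsOfRecord ϑ.ν g k) a V = 1)
    (hu' : ∀ V, ‖(Φ V).2‖ < epsOfRecord ϑ.ν g k * (1 - ρ) ↔
      cubeChiAt F N ϑ.ν g p.K k (epsOfRecord ϑ.ν g k * (1 - ρ)) a V = 1) :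
    ∑ s, shellPieceOfDatum₉ F N ϑ Dt g₀ os p g k ρ t a s
      ≤ (3 * ((Fintype.card κ : ℝ) + 1) * (1 + 0) / (1 * (1 - ρ)) * Mdom * ρ)
        * ∑ s, cubeWeightOfDatum₉ F N ϑ Dt g₀ os p g k t a s := by
  have hEND := slotAntiConcentration_chartLetter_of_sect1Letters ζ K φ Qf lin Vt hg hε hρ0 hρ1 hd hM hγ₀ hW hK hφ h0K
    hexp h19 h16 hV hclause
  have hD0 : 0 ≤ 3 * ((Fintype.card κ : ℝ) + 1) * (1 + 0) / (1 * (1 - ρ)) := by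
    have : 0 < 1 - ρ := by linarith
    positivity
  have h1 := slotAntiConcentration_of_dominated hD0 hρ0.le hS hEND hmass
  have h2 : SlotAntiConcentration (cubeLawOfDatum₉ F N ϑ Dt g₀ os p g k t a) ((fun q : X × (κ → ℝ) => ‖q.2‖) ∘ Φ)
      (epsOfRecord ϑ.ν g k) ρ (3 * ((Fintype.card κ : ℝ) + 1) * (1 + 0) / (1 * (1 - ρ)) * Mdom) :=
    slotAntiConcentration_comap hΦ h1
  exact cubeAC_of_slotAntiConcentration F N ϑ Dt g₀ os p g k hUbg hw0 hρ0.le t a hint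
    ((fun q : X × (κ → ℝ) => ‖q.2‖) ∘ Φ) hu hu' (mul_nonneg hD0 hMdom) h2

end Summit.QuantumFields.YangMills.Theorems.N21LowCentreEndAtCubeLaw

end
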